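import Mathlib.Algebra.BigOperators.Ring.Finset
import Mathlib.Algebra.Field.Basic
import Mathlib.Data.Fintype.Basic
import Mathlib.Data.Finset.Piecewise
import Mathlib.Tactic.FieldSimp
import Mathlib.Tactic.Ring
import HarnessLib

/-!
# Separation of variables on a finite product

Topic `Analysis/FunctionSpaces`; namespace `Literature.Analysis.FunctionSpaces`. Theorems only (no
definition, no named fact): the elementary bookkeeping behind "a function of several variables which,
in each variable separately, is a fixed function of that variable times a factor not depending on it, is
a constant multiple of the product":

* `exists_eq_const_mul_prod` — let `Φ : (Π i, X i) → R` (`ι` finite, `R` a field) and `F i : X i → R`;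
  if for every coordinate `i` there is `c_i : (Π i, X i) → R`, invariant under changing the `i`-th
  coordinate, with `Φ u = c_i u · F i (u i)` for all `u`, then `Φ u = C · ∏ i, F i (u i)` for a constant `C`.

(Used for the Kirillov functions of `GL₂(K_∞)` along the torus `K_∞ˣ = ∏_v K_vˣ`, where the differential
equations of each place give the factorisation one coordinate at a time.) The proof is the induction on
the set `S` of separated coordinates (`exists_factor_finsetProd`), choosing at each stage base points where
the already separated factors do not vanish (or observing that `Φ ≡ 0`); coordinates are replaced with
Mathlib's `Finset.piecewise`. [folklore]
-/

namespace Literature.Analysis.FunctionSpaces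

open Finset

variable {ι : Type*} [DecidableEq ι] {X : ι → Type*} {R : Type*}

/-- A function invariant under changing each coordinate in `S` is invariant under replacing all the
coordinates in `S` (`Finset.piecewise`). [folklore] -/
theorem apply_piecewise_eq_of_forall_update (S : Finset ι) {c : (∀ i, X i) → R}
    (hc : ∀ i ∈ S, ∀ (u : ∀ i, X i) (y : X i), c (Function.update u i y) = c u) (x u : ∀ i, X i) :
    c (S.piecewise x u) = c u := by
  induction S using Finset.induction_on with
  | empty => rw [piecewise_empty]
  | @insert j T hj ih =>
    rw [piecewise_insert, hc j (mem_insert_self j T), ih (fun i hi => hc i (mem_insert_of_mem hi))]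

variable [Field R]

/-- **Separation of variables over a finite set of coordinates** (the induction): under the hypothesis
of `exists_eq_const_mul_prod`, for every finite `S` there is `c_S`, invariant under changing each
coordinate in `S`, with `Φ u = c_S u · ∏_{i ∈ S} F i (u i)`. [folklore] -/
theorem exists_factor_finsetProd (Φ : (∀ i, X i) → R) (F : ∀ i, X i → R)
    (h : ∀ i, ∃ c : (∀ i, X i) → R, (∀ (u : ∀ i, X i) (y : X i), c (Function.update u i y) = c u) ∧
      ∀ u, Φ u = c u * F i (u i))
    (hne : ∀ i, Nonempty (X i)) (S : Finset ι) :
    ∃ c : (∀ i, X i) → R, (∀ i ∈ S, ∀ (u : ∀ i, X i) (y : X i), c (Function.update u i y) = c u) ∧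
      ∀ u, Φ u = c u * ∏ i ∈ S, F i (u i) := by
  classical
  induction S using Finset.induction_on with
  | empty => exact ⟨Φ, fun i hi => (notMem_empty i hi).elim, fun u => by simp⟩
  | @insert j S hj ih =>
    obtain ⟨cS, hcS, hΦS⟩ := ih
    obtain ⟨cj, hcj, hΦj⟩ := h j
    by_cases hA : ∀ i ∈ S, ∃ y : X i, F i y ≠ 0
    · -- base points where the separated factors do not vanish
      let x : ∀ i, X i := fun i => if hi : (∃ y : X i, F i y ≠ 0) then Classical.choose hi else Classical.choice (hne i)
      have hx : ∀ i ∈ S, F i (x i) ≠ 0 := fun i hi => by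
        have h' := hA i hi
        simp only [x, dif_pos h']
        exact Classical.choose_spec h'
      set P₀ : R := ∏ i ∈ S, F i (x i) with hP₀
      have hP₀ne : P₀ ≠ 0 := prod_ne_zero_iff.2 hx
      -- `c_S u · P₀ = c_j (ũ) F_j(u_j)` with `ũ = S.piecewise x u`
      have key : ∀ u, cS u * P₀ = cj (S.piecewise x u) * F j (u j) := fun u => by
        have h1 := hΦS (S.piecewise x u)
        have h2 := hΦj (S.piecewise x u)
        rw [apply_piecewise_eq_of_forall_update S hcS] at h1
        have hprod : ∏ i ∈ S, F i (S.piecewise x u i) = P₀ :=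
          prod_congr rfl fun i hi => by rw [piecewise_eq_of_mem _ _ _ hi]
        rw [hprod] at h1
        rw [piecewise_eq_of_notMem _ _ _ hj] at h2
        rw [← h1, ← h2]
      refine ⟨fun u => cj (S.piecewise x u) / P₀, fun i hi u y => ?_, fun u => ?_⟩
      · show cj (S.piecewise x (Function.update u i y)) / P₀ = cj (S.piecewise x u) / P₀
        rcases mem_insert.1 hi with rfl | hiS
        · -- changing the new coordinate `j ∉ S`
          rw [← update_piecewise_of_notMem _ _ _ hj, hcj]
        · -- changing a coordinate of `S`
          have hrep : S.piecewise x (Function.update u i y) = S.piecewise x u :=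
            S.piecewise_congr (fun _ _ => rfl) fun k hk =>
              Function.update_of_ne (fun e : k = i => hk (by rw [e]; exact hiS)) ..
          rw [hrep]
      · show Φ u = cj (S.piecewise x u) / P₀ * ∏ i ∈ insert j S, F i (u i)
        rw [prod_insert hj, hΦS u, eq_div_of_mul_eq hP₀ne (key u)]
        ring
    · -- some separated factor vanishes identically: `Φ ≡ 0`
      have hA' : ∃ i ∈ S, ∀ y : X i, F i y = 0 := by simpa using hA
      obtain ⟨i, hiS, hi⟩ := hA'
      refine ⟨fun _ => 0, fun _ _ _ _ => rfl, fun u => ?_⟩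
      rw [hΦS u, zero_mul]
      exact mul_eq_zero_of_right _ (prod_eq_zero hiS (hi (u i)))

/-- **Separation of variables on a finite product.** If `Φ : (Π i, X i) → R` satisfies, for every
coordinate `i`, `Φ u = c_i u · F i (u i)` with `c_i` invariant under changing the `i`-th coordinate, then
`Φ = C · ∏ i, F i (u i)` for a constant `C`. [folklore] -/
theorem exists_eq_const_mul_prod [Fintype ι] (Φ : (∀ i, X i) → R) (F : ∀ i, X i → R)
    (h : ∀ i, ∃ c : (∀ i, X i) → R, (∀ (u : ∀ i, X i) (y : X i), c (Function.update u i y) = c u) ∧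
      ∀ u, Φ u = c u * F i (u i)) :
    ∃ C : R, ∀ u, Φ u = C * ∏ i, F i (u i) := by
  classical
  by_cases hne : ∀ i, Nonempty (X i)
  · obtain ⟨c, hc, hΦ⟩ := exists_factor_finsetProd Φ F h hne univ
    by_cases hu : Nonempty (∀ i, X i)
    · obtain ⟨u₀⟩ := hu
      refine ⟨c u₀, fun u => ?_⟩
      rw [hΦ u]
      congr 1
      -- `c` is invariant under changing every coordinate, hence constant
      have h1 := apply_piecewise_eq_of_forall_update univ (fun i _ => hc i (mem_univ i)) u u₀
      rwa [piecewise_univ] at h1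
    · exact ⟨0, fun u => (hu ⟨u⟩).elim⟩
  · obtain ⟨i, hi⟩ := not_forall.mp hne
    exact ⟨0, fun u => (hi ⟨u i⟩).elim⟩

end Literature.Analysis.FunctionSpaces
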